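import Summits.HubbardSuperconductivity.HubbardSuperconductivity.Theorems.AnisotropyChordTransferFibre3RowDBLines

/-!
# Route `AnisotropyChord` / H0 rotor rung, row D (KT-2a) Stage-1 evaluator: the `D`-boundary closed half `bClosedU/(V²t)` as an `RExpr` pair

Layer F2b of the row-D program (p1 g29 memo ROWD-DESIGN-g29 §6; F2a = `…RowDBLines`).  g29's `bClosedU = bLinesG closed2U …` is the
nine-term boundary combination with every pair transform replaced by its closed part `closed2U ψ ψ′ q = α₁α₂V[q=0]W₁W₂ + α₁W₁R_ψ′(q) + α₂W₂R_ψ(q)`.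
For the three weight patterns occurring — (plain, gradient), (shift, plain), (plain, shift) — `closed2U/V` is an `RExpr` pair in the row-D atoms:
★ `zPG x y q e = α_x·(1−e^{−iθ q·e})·ρ⁰_y(q)` (a SMALL pair made ordinary, `ofS`), ★ `zSP`, ★ `zPS` (`α_xα_y d(q) + α_x ρ⁰_y + α_y e^{−iθq·e}ρ⁰_x`,
phases ★ `pph m`), with ★ `zPG_eval/zSP_eval/zPS_eval : V·peval = closed2U(…)(q̄)`; point values ★ `pvE` (`J ↦ a`, `S ↦ η = π²ν = η_eff`,
★ `eval_pvE`).  The nine-term assembly `bLinesE`/`bTermE` with `bTermE_eval : V²·t·peval(bTermE) = bClosedU(k̄₂,k̄₃)` is the sibling `…RowDBLinesE`.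
Prover seat `hubbard-h0-rotor-p1` g30 (route lead); helper for piece A = stmt-HubbardSuperconductivity-23918 of rung 19089
(`--supports`, helper class).  Nothing here proves superconductivity in the Hubbard model; lemmas for ONE row of ONE conditional reduction;
the rotor TARGET as originally worded stays FALSE (g15 verdict).  Tree imports only; no sorry.
-/

set_option linter.dupNamespace false
set_option autoImplicit false

open Literature.Analysis.ValidatedNumerics

namespace Summit.HubbardSuperconductivity.HubbardSuperconductivity.Theorems.AnisotropyChord.Transfer.Fibre3

namespace RowD

open RowC L2.N1

variable (L : ℕ) [NeZero L]

/-! ## Small helpers: small-to-ordinary, signed phases, point values -/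

/-- a SMALL pair `(x, y) ≙ t·x + iθ·y` read as an ORDINARY pair `(t·x, y)`. -/
def ofS (p : RExpr × RExpr) : RExpr × RExpr := (.mul yT p.1, p.2)

/-- the phase `e^{−iθm}` for a signed multiplier `|m| ≤ 3` (`1` for `m = 0`). -/
def pph (m : ℤ) : RExpr × RExpr :=
  if m = 0 then preal (cst 1) else if 0 < m then phaseDpos m.natAbs else phaseDneg m.natAbs

/-- the point value of a slot at a nearest neighbour as an `RExpr`: `J ↦ a`, `S ↦ η = π²ν`. -/
def pvE (kind : Bool) : RExpr := if kind then eta else vA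

section helpers
variable (Δ lam2 : ℝ) (f : Tor L → ℝ)

/-- `peval (ofS p) = seval p`. [folklore] -/
theorem peval_ofS (p : RExpr × RExpr) :
    peval (2 * Real.pi / L) (xTrueD L Δ lam2 f) (ofS p) = seval (2 * Real.pi / L) (xTrueD L Δ lam2 f) p := by
  simp only [peval, seval, ofS, RExpr.eval, yT, xTrueD_zero]

/-- ★ `pph m ↦ e^{−iθm}` (`|m| ≤ 3`, `L ≥ 3`). [folklore] -/
theorem peval_pph (hL : 3 ≤ L) {m : ℤ} (hm : m.natAbs ≤ 3) :
    peval (2 * Real.pi / L) (xTrueD L Δ lam2 f) (pph m)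
      = Complex.exp (-(Complex.I * ((2 * Real.pi / L : ℝ) : ℂ) * (m : ℂ))) := by
  unfold pph
  by_cases h0 : m = 0
  · rw [if_pos h0, h0, peval_preal]; simp [cst, RExpr.eval]
  · rw [if_neg h0]
    have hm1 : 1 ≤ m.natAbs := Int.natAbs_pos.mpr h0
    obtain ⟨hp, hn⟩ := peval_phaseD L hL Δ lam2 f m.natAbs hm1 hm
    by_cases hpos : 0 < m
    · rw [if_pos hpos, hp]
      congr 2
      have : ((m.natAbs : ℕ) : ℤ) = m := Int.natAbs_of_nonneg hpos.le
      rw [this]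
    · rw [if_neg hpos, hn]
      congr 2
      have : -((m.natAbs : ℕ) : ℤ) = m := by
        have := Int.ofNat_natAbs_of_nonpos (not_lt.mp hpos); omega
      rw [this]

/-- `pph (q·e) = conj(phase q̄ ē)` at integer points (`|q·e| ≤ 3`). [folklore] -/
theorem peval_pph_phase (hL : 3 ≤ L) (q e : ℤ × ℤ) (hm : (qdot q e).natAbs ≤ 3) :
    peval (2 * Real.pi / L) (xTrueD L Δ lam2 f) (pph (qdot q e)) = (starRingEnd ℂ) (phase L (B1.toTor L q) (B1.toTor L e)) := by
  rw [peval_pph L Δ lam2 f hL hm, conj_phase_toTor_E4]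

/-- ★ `eta ↦ η_eff = Vλ₂/4` and `vA ↦ a` at the row-D vector: `pvE kind ↦ pvR kind`. [folklore] -/
theorem eval_pvE (kind : Bool) : (pvE kind).eval (xTrueD L Δ lam2 f) = pvR L Δ lam2 f kind := by
  unfold pvE pvR
  cases kind
  · simp only [Bool.false_eq_true, if_false, vA, RExpr.eval]; exact xTrueD_three L Δ lam2 f
  · simp only [if_true, eta, vPi2, vNu, RExpr.eval]
    rw [xTrueD_one, xTrueD_two]
    unfold etaEff
    have hL : (L : ℝ) ≠ 0 := by exact_mod_cast NeZero.ne L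
    have hπ : Real.pi ≠ 0 := Real.pi_ne_zero
    field_simp
    ring

omit [NeZero L] in
/-- the shifted regular factor is the phase times the plain one. [folklore] -/
theorem rfacU_shift (lam2' : ℝ) (kind : Bool) (e q : Tor L) :
    RfacU L lam2' (psiU L Δ lam2' f kind 0 1 e) q = (starRingEnd ℂ) (phase L q e) * RfacU L lam2' (psiU L Δ lam2' f kind 1 0 e) q := by
  cases kind <;> simp only [RfacU, psiU, Bool.false_eq_true, if_false, if_true] <;> push_cast <;> ring

end helpers

/-! ## The three two-slot closed parts as pairs -/

/-- (plain `x`) × (gradient `y` along `e`): `closed2U/V = α_x·(1 − e^{−iθ q·e})·ρ⁰_y(q)`. -/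
def zPG (x y : Bool) (q e : ℤ × ℤ) : RExpr × RExpr := ofS (sscale (.mul (alE x) (rE y q)) (swt (qdot q e)))

/-- (shift `x` by `e`) × (plain `y`): `closed2U/V = α_xα_y d(q) + α_x ρ⁰_y(q) + α_y e^{−iθq·e} ρ⁰_x(q)`. -/
def zSP (x y : Bool) (q e : ℤ × ℤ) : RExpr × RExpr :=
  padd (preal (.add (.mul (.mul (alE x) (alE y)) (dI q)) (.mul (alE x) (rE y q)))) (pscale (.mul (alE y) (rE x q)) (pph (qdot q e)))

/-- (plain `x`) × (shift `y` by `e`): `closed2U/V = α_xα_y d(q) + α_x e^{−iθq·e} ρ⁰_y(q) + α_y ρ⁰_x(q)`. -/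
def zPS (x y : Bool) (q e : ℤ × ℤ) : RExpr × RExpr :=
  padd (preal (.add (.mul (.mul (alE x) (alE y)) (dI q)) (.mul (alE y) (rE x q)))) (pscale (.mul (alE x) (rE y q)) (pph (qdot q e)))

section zeval
variable (Δ lam2 : ℝ) (f : Tor L → ℝ)

omit [NeZero L] in
/-- the components of a typed spec. [folklore] -/
theorem psiU_shape (kd : Bool) (u u' : ℝ) (e : Tor L) :
    psiU L Δ lam2 f kd u u' e = (e, u, u', (psiU L Δ lam2 f kd u u' e).2.2.2.1,
      (psiU L Δ lam2 f kd u u' e).2.2.2.2.1, (psiU L Δ lam2 f kd u u' e).2.2.2.2.2) := by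
  cases kd <;> simp [psiU]

omit [NeZero L] in
/-- the `δ`-coefficient does not depend on the weight data. [folklore] -/
theorem psiU_alpha (kd : Bool) (u u' u₁ u₁' : ℝ) (e e' : Tor L) :
    (psiU L Δ lam2 f kd u u' e).2.2.2.1 = (psiU L Δ lam2 f kd u₁ u₁' e').2.2.2.1 := by
  cases kd <;> simp [psiU]

/-- ★ `V·peval(zPG x y q e) = closed2U(ψ_x plain, ψ_y grad ē)(q̄)` (`q` a grid point or `0`, `|q·e| ≤ 3`; ground profile, `L ≥ 5`). [folklore] -/
theorem zPG_eval (hL : 5 ≤ L) (hΔ0 : 0 ≤ Δ) (hΔ1 : Δ < 1) (hf : IsGroundTwoMagnon L Δ lam2 f) (hlam : 0 < lam2)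
    (x y : Bool) (e0 : Tor L) {q : ℤ × ℤ} (hq : q = (0, 0) ∨ q ∈ gridPts 3) (e : ℤ × ℤ) (hm : (qdot q e).natAbs ≤ 3) :
    (L : ℂ) ^ 2 * peval (2 * Real.pi / L) (xTrueD L Δ lam2 f) (zPG x y q e)
      = closed2U L lam2 (psiU L Δ lam2 f x 1 0 e0) (psiU L Δ lam2 f y 1 (-1) (B1.toTor L e)) (B1.toTor L q) := by
  have hV : (L : ℂ) ^ 2 ≠ 0 := by
    have : (L : ℂ) ≠ 0 := by exact_mod_cast NeZero.ne L
    positivity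
  have ax := eval_alE L Δ lam2 f hL hΔ0 hΔ1 hf hlam x 1 0 e0
  have wy := eval_rEw L Δ lam2 f hL hΔ0 hΔ1 hf hlam y e hq hm
  rw [psiU_shape L Δ lam2 f x 1 0 e0, psiU_shape L Δ lam2 f y 1 (-1) (B1.toTor L e)]
  unfold closed2U
  simp only []
  push_cast
  rw [← psiU_shape L Δ lam2 f y 1 (-1) (B1.toTor L e), ← (eq_div_iff hV).mp wy, ← ax]
  unfold zPG
  rw [peval_ofS, seval_sscale]
  simp only [RExpr.eval]
  push_cast
  field_simp
  ring

/-- ★ `V·peval(zSP x y q e) = closed2U(ψ_x shift ē, ψ_y plain ē)(q̄)` (`q` grid or `0`, `|q·e| ≤ 3`; `L ≥ 7`). [folklore] -/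
theorem zSP_eval (hL : 7 ≤ L) (hΔ0 : 0 ≤ Δ) (hΔ1 : Δ < 1) (hf : IsGroundTwoMagnon L Δ lam2 f) (hlam : 0 < lam2)
    (x y : Bool) {q : ℤ × ℤ} (hq : q = (0, 0) ∨ q ∈ gridPts 3) (e : ℤ × ℤ) (hm : (qdot q e).natAbs ≤ 3) (e' : Tor L) :
    (L : ℂ) ^ 2 * peval (2 * Real.pi / L) (xTrueD L Δ lam2 f) (zSP x y q e)
      = closed2U L lam2 (psiU L Δ lam2 f x 0 1 (B1.toTor L e)) (psiU L Δ lam2 f y 1 0 e') (B1.toTor L q) := by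
  have hL5 : 5 ≤ L := by omega
  have hV : (L : ℂ) ^ 2 ≠ 0 := by
    have : (L : ℂ) ≠ 0 := by exact_mod_cast NeZero.ne L
    positivity
  have ax := eval_alE L Δ lam2 f hL5 hΔ0 hΔ1 hf hlam x 0 1 (B1.toTor L e)
  have ay := eval_alE L Δ lam2 f hL5 hΔ0 hΔ1 hf hlam y 1 0 e'
  have ry := eval_rE0 L Δ lam2 f hL5 hΔ0 hΔ1 hf hlam y e' hq
  have rx := eval_rE0 L Δ lam2 f hL5 hΔ0 hΔ1 hf hlam x (B1.toTor L e) hq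
  have hd := eval_dI L hL hq (xTrueD L Δ lam2 f)
  have hph := peval_pph_phase L Δ lam2 f (by omega) q e hm
  have hsh := rfacU_shift L Δ f lam2 x (B1.toTor L e) (B1.toTor L q)
  rw [psiU_shape L Δ lam2 f x 0 1 (B1.toTor L e), psiU_shape L Δ lam2 f y 1 0 e']
  unfold closed2U
  simp only []
  push_cast
  rw [← psiU_shape L Δ lam2 f x 0 1 (B1.toTor L e), ← psiU_shape L Δ lam2 f y 1 0 e', hsh,
    psiU_alpha L Δ lam2 f x 0 1 1 0 (B1.toTor L e) (B1.toTor L e)]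
  have ery : RfacU L lam2 (psiU L Δ lam2 f y 1 0 e') (B1.toTor L q) = (L : ℂ) ^ 2 * (((rE y q).eval (xTrueD L Δ lam2 f) : ℝ) : ℂ) := by
    rw [← (eq_div_iff hV).mp ry]; ring
  have erx : RfacU L lam2 (psiU L Δ lam2 f x 1 0 (B1.toTor L e)) (B1.toTor L q) = (L : ℂ) ^ 2 * (((rE x q).eval (xTrueD L Δ lam2 f) : ℝ) : ℂ) := by
    rw [← (eq_div_iff hV).mp rx]; ring
  rw [ery, erx, ← hd]
  unfold zSP
  rw [peval_padd, peval_preal, peval_pscale, hph.symm]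
  rw [← ay, ← eval_alE L Δ lam2 f hL5 hΔ0 hΔ1 hf hlam x 1 0 (B1.toTor L e)]
  simp only [RExpr.eval]
  push_cast
  ring

/-- ★ `V·peval(zPS x y q e) = closed2U(ψ_x plain ē, ψ_y shift ē)(q̄)` (`q` grid or `0`, `|q·e| ≤ 3`; `L ≥ 7`). [folklore] -/
theorem zPS_eval (hL : 7 ≤ L) (hΔ0 : 0 ≤ Δ) (hΔ1 : Δ < 1) (hf : IsGroundTwoMagnon L Δ lam2 f) (hlam : 0 < lam2)
    (x y : Bool) {q : ℤ × ℤ} (hq : q = (0, 0) ∨ q ∈ gridPts 3) (e : ℤ × ℤ) (hm : (qdot q e).natAbs ≤ 3) (e' : Tor L) :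
    (L : ℂ) ^ 2 * peval (2 * Real.pi / L) (xTrueD L Δ lam2 f) (zPS x y q e)
      = closed2U L lam2 (psiU L Δ lam2 f x 1 0 e') (psiU L Δ lam2 f y 0 1 (B1.toTor L e)) (B1.toTor L q) := by
  have hL5 : 5 ≤ L := by omega
  have hV : (L : ℂ) ^ 2 ≠ 0 := by
    have : (L : ℂ) ≠ 0 := by exact_mod_cast NeZero.ne L
    positivity
  have ax := eval_alE L Δ lam2 f hL5 hΔ0 hΔ1 hf hlam x 1 0 e'
  have ay := eval_alE L Δ lam2 f hL5 hΔ0 hΔ1 hf hlam y 0 1 (B1.toTor L e)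
  have ry := eval_rE0 L Δ lam2 f hL5 hΔ0 hΔ1 hf hlam y (B1.toTor L e) hq
  have rx := eval_rE0 L Δ lam2 f hL5 hΔ0 hΔ1 hf hlam x e' hq
  have hd := eval_dI L hL hq (xTrueD L Δ lam2 f)
  have hph := peval_pph_phase L Δ lam2 f (by omega) q e hm
  have hsh := rfacU_shift L Δ f lam2 y (B1.toTor L e) (B1.toTor L q)
  rw [psiU_shape L Δ lam2 f x 1 0 e', psiU_shape L Δ lam2 f y 0 1 (B1.toTor L e)]
  unfold closed2U
  simp only []
  push_cast
  rw [← psiU_shape L Δ lam2 f x 1 0 e', ← psiU_shape L Δ lam2 f y 0 1 (B1.toTor L e), hsh,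
    psiU_alpha L Δ lam2 f y 0 1 1 0 (B1.toTor L e) (B1.toTor L e)]
  have ery : RfacU L lam2 (psiU L Δ lam2 f y 1 0 (B1.toTor L e)) (B1.toTor L q) = (L : ℂ) ^ 2 * (((rE y q).eval (xTrueD L Δ lam2 f) : ℝ) : ℂ) := by
    rw [← (eq_div_iff hV).mp ry]; ring
  have erx : RfacU L lam2 (psiU L Δ lam2 f x 1 0 e') (B1.toTor L q) = (L : ℂ) ^ 2 * (((rE x q).eval (xTrueD L Δ lam2 f) : ℝ) : ℂ) := by
    rw [← (eq_div_iff hV).mp rx]; ring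
  rw [ery, erx, ← hd]
  unfold zPS
  rw [peval_padd, peval_preal, peval_pscale, hph.symm]
  rw [← ax, ← eval_alE L Δ lam2 f hL5 hΔ0 hΔ1 hf hlam y 1 0 (B1.toTor L e)]
  simp only [RExpr.eval]
  push_cast
  ring

end zeval

end RowD

end Summit.HubbardSuperconductivity.HubbardSuperconductivity.Theorems.AnisotropyChord.Transfer.Fibre3
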